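import Literature.MathematicalPhysics.QuantumFieldTheory.Balaban1983to89.B11Ineq190FromProp3
import Literature.MathematicalPhysics.QuantumFieldTheory.Balaban1983to89.B11Prop3Concrete

/-!
# `Balaban1983to89.B11Ineq190ConcreteC` — T. Bałaban, *The variational problem and background fields in renormalization group method for lattice
gauge theories*, Commun. Math. Phys. **102** (1985) 277–309 [Balaban1985Variational], Sect. G (190) p. 308 with Sect. C (44)/(47)/(72) pp. 285–289:
**THE END-TO-END (190) CHAIN WITH THE SECT. C TRANSFORMATION CONCRETE** — `B11Ineq190FromProp3.ineq190_and_hmv_supSize_of_inputs` (r08 g10: the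
B14/B15 consumers' pair `(h190 on supSize, hmv)` for the actual derivative of the (179) chart, Sect. C letters reduced to Prop. 3's `Inputs` +
analyticity of `C`) INSTANTIATED at the CONCRETE remainder `C_j(U₀, ·)` of [4] on the `ℤᵈ` carrier (`B11Eq44Concrete.Cmap`, p06), where `Inputs`
is the theorem `B11Prop3Concrete.inputs_concrete` (r08 g10) and analyticity the theorem `B12SecondOrder267Concrete.analyticOnNhd_Cmap` (p06):
the first (190)-statement of the tree in which an input from [4]–[6] is a THEOREM rather than a letter — the Sect. G data `G̃`, `W = (δ/δA′)V`,
`Δ⁽²⁾`, `H₀`, `H` stay abstract continuous linear / analytic data on the concrete carriers `𝔸^S` (the A′-space) and `𝔸^T` (the B-space)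

statement-level skeleton of published theorems with citation tags; proofs where landed; nothing here is a claim about the Yang–Mills mass gap

PDF held: `paper:balaban1985-cmp102-variational-background` (journal page = PDF page + 276); pp. 285–289 [PDF 9–13], 306–308 [PDF 30–32]; [4] =
[Balaban1985Averaging] `paper:balaban1985-cmp98-averaging` Props. 4–5 pp. 38–42.

CITATION HEADER / WHAT IS REPRODUCED.  Mega-formalization `lit-balaban`, HOME `run/shared/lean/pub/lit-balaban/`, reader/typer/fold-owner seat
r08 gen 10 (unit `lit-balaban-r08`).  SKELETON rows **B11.Eq190** / **B11.Prop9** / **B11.Prop3** (cells; heads unchanged).  THE PRINT: (190) p. 308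
and Prop. 9 p. 309 *«its functional derivative (182) satisfies the inequalities (190)»* (quoted in `B11Ineq190Actual`); Prop. 3 p. 289 and (44)
p. 285 [PDF 9] *«The Proposition 4 of [4] implies Q_j(ηA) = L^jηQ_jA + C_j(L^jηA), |C_j(L^jηA)| ≤ C₂(L^jη)²|A|². (44)»* — the analyticity of
`C_j` used below is [4] Prop. 4 p. 38 *«… is an analytic function of the variables A_b …»*, not a word of (44) —, (72) p. 289 *«Proposition 5
of [4] implies …»* (quoted in `B11Prop3Concrete`).
(v1.1 DOCFIX, r08 gen 28: the v1 header carried «implies that it is an analytic function of A and …» INSIDE the (44) quotation — reader r12 g19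
QUOTE-AUDIT-B15 §E X1 (a); not printed at (44) p. 285 (page image checked); replaced by the verbatim display and the [4] Prop. 4 attribution;
the statement and its proof byte-identical.)

WHAT THIS FILE PROVES (one theorem; kernel-checked, 0 sorry, standard axioms).  **`ineq190_and_hmv_supSize_concreteC`**: in the regime of
`B11Eq44Concrete`/`B11Eq72Concrete` (regular background `U₀` on `ℤᵈ`, witness radius `b`, [4] smallness incl. `h145`/`h155`, `j ≤ k`), for the
Sect. G scheme data on the carriers `𝒴 := 𝔸^S ∋ A′`, `𝒳 := 𝔸^T ∋ B` (`𝒢 : 𝒵 →L[ℂ] 𝔸^S`, `W : 𝔸^S → 𝒵`, `D2 : 𝔸^S →L[ℂ] 𝒵`, `H₀ H : 𝔸^T →L[ℂ] 𝔸^S`,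
`Regime`), with `C := Cmap L U₀ S T j`, `D := Dfix (Cmap …) H (C₂(Lʲ)²)`, the Prop. 3 smallness in tree units (`18·C₂(Lʲ)²·B₀′·ε₃ ≤ 1`,
`2ε₃ ≤ b/2`) and `ε₄ + a ≤ ε₃`: the consumers' pair `(∀ t ∈ [0,1], Ineq190 bB (supSize g box blk) (dH t) const190 δ₀) ∧ hmv` for any lattice
presentation of the (179) chart — hypotheses left: the located leaves of `B11Ineq190Actual` ((189), kernel letters of G̃/H₀/H/Δ⁽²⁾H₀, the (73)-DECAY
letter for `fderiv ℂ (Dfix …)` at the points, Lemma 2.1 `RowSum`, (2.54), (187) smallness, size↔norm compatibility), the Sect. G `Regime` and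
`W`-analyticity, and (46) `‖HX‖ ≤ B₀′‖X‖`.

HONEST SCOPE.  One application of `B11Ineq190FromProp3.ineq190_and_hmv_supSize_of_inputs` to `B11Prop3Concrete.inputs_concrete` and
`B12SecondOrder267Concrete.analyticOnNhd_Cmap`; nothing of [5]/[6] is constructed (G̃, W, Δ⁽²⁾, H₀, H abstract); the block geometry `g` and the
sizes `bB`, `bN`, `b3`, the presentation `ev` are parameters; NE9 socket C19′ frozen; not summit progress.  Imports `B11Ineq190FromProp3` (r08 g10),
`B11Prop3Concrete` (r08 g10 → p06's concrete files); modifies nothing; no new named fact (net debt delta 0).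
-/

noncomputable section

namespace Literature.MathematicalPhysics.QuantumFieldTheory.Balaban1983to89.B11Ineq190ConcreteC

open Literature.MathematicalPhysics.QuantumFieldTheory.Balaban1983to89
open B7Prop1Explicit B7Prop1Local B7Prop2Explicit B7Prop3Flat B7Prop4Flat B7Eq92Concrete B7Prop3GeneralLinear
  B7Prop4GeneralLevels B7Prop5GeneralOperators B7Prop5GeneralInduction B7Prop5GeneralLevels B7Prop5General B7Ineq149Pairing
  B13Contraction113 B11SectG B11Eq174Chart B11Eq183Differentiation B11Presentation190 B11SupSize190 B11Ineq190Actual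
  B11Ineq190FromProp3 B11Prop3Model B6RandomWalk Set Metric

-- the `ℤ^d` sites of `B7Prop1Explicit` are written `B7Prop1Explicit.Site` (the bare name would resolve to the torus sites of `Setup.lean`).

variable {d : ℕ} {𝔸 : Type} [NormedRing 𝔸] [NormedAlgebra ℂ 𝔸] [CompleteSpace 𝔸] [NormOneClass 𝔸]

variable (L : ℕ) (hL : 2 ≤ L) {G : Subgroup 𝔸ˣ} (hG : AvgClosed d L G) (k : ℕ)
  (U₀ : B7Prop1Explicit.Site d → Fin d → 𝔸ˣ) (hU₀ : ∀ x κ, U₀ x κ ∈ G) {α₀ : ℝ} (hα : 0 < α₀)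
  (hα3 : C0 d * α₀ ≤ 1 / 3) (hα4 : 4 * α₀ ≤ c2' d L) (h52 : pdev U₀ < α₀ * (((L : ℝ) ^ k)⁻¹) ^ 2)
  {b : ℝ} (hb : 0 < b)
  (hsmall : Real.exp (4 * (800 * ((d : ℝ) + 1) ^ 2 * ((d : ℝ) + 4)) * α₀)
    * (1 + 8 * (131072 * ((d : ℝ) + 1) ^ 2) * ((L : ℝ) ^ k * b)) ≤ 2)
  (hc₃ : 4 * ((L : ℝ) ^ k * b) < c3 d L)
  (h145 : 8 * d * thetaGen d L α₀ * (L : ℝ)⁻¹ ^ 4 ≤ 1)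
  (h155 : (2 * (L : ℝ) - 1) * (L : ℝ)⁻¹ ^ 2 + 2 * d * thetaGen d L α₀ * (L : ℝ)⁻¹ ^ 3
    + 1 / 8 * (1 + 2 * d * thetaGen d L α₀ * (L : ℝ)⁻¹ ^ 2 + 2 * d * C3Gen d L * ((L : ℝ) ^ k * b)) * (L : ℝ)⁻¹ ^ 2 ≤ 1)
  (S T : Finset (B7Prop1Explicit.Site d × Fin d))

variable {𝒵 : Type} [NormedAddCommGroup 𝒵] [NormedSpace ℂ 𝒵] [CompleteSpace 𝒵]
  {𝒢 : 𝒵 →L[ℂ] (S → 𝔸)} {W : (S → 𝔸) → 𝒵} {D2 : (S → 𝔸) →L[ℂ] 𝒵} {H₀ : (T → 𝔸) →L[ℂ] (S → 𝔸)} {B₀ θ C₄ a₃ jG a ε₄ : ℝ}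
  {g : B6.Geometry} {X : Type} {E : Type} [NormedAddCommGroup E] [NormedSpace ℝ E] {box : g.Site → Finset X} {blk : X → g.Site}

include hL hG hU₀ hα hα3 hα4 h52 hb hsmall hc₃ h145 h155 in
/-- **The end-to-end (190) chain with the Sect. C transformation CONCRETE** — `B11Ineq190FromProp3.ineq190_and_hmv_supSize_of_inputs` at
`C := Cmap L U₀ S T j` (the remainder `C_j(U₀, ·)` of [4] on `ℤᵈ`), `Inputs` supplied by `B11Prop3Concrete.inputs_concrete` ([4] Props 4/5
concretely) and the analyticity of `C` by `B12SecondOrder267Concrete.analyticOnNhd_Cmap` ([4] Prop. 4); `H` abstract with (46); the Sect. G data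
`𝒢`, `W`, `D2`, `H₀` abstract on the concrete carriers `𝔸^S`/`𝔸^T`; conclusion = the B14/B15 consumers' pair for any lattice presentation of the
(179) chart `𝓗(B) = Tm(𝒜₀(B) + H₀B)`, `Tm = A′ ↦ A′ − H·Dfix(A′)`. [cite: Balaban1985Variational, Prop. 9 (190) pp.308–309, Prop. 3 p.289, (44) p.285, (72) p.289]
[cite: Balaban1985Averaging, Prop. 4 p.38, Prop. 5 p.42] -/
theorem ineq190_and_hmv_supSize_concreteC {j : ℕ} (hj : j ≤ k) (hd1 : 1 ≤ d)
    (R : Regime 𝒢 0 W B₀ θ C₄ a₃ jG a ε₄) (hWa : AnalyticOnNhd ℂ W {Y : S → 𝔸 | ‖Y‖ < a₃})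
    (H : (T → 𝔸) →L[ℂ] (S → 𝔸)) {B₀' : ℝ} (hB₀' : 0 ≤ B₀') (hH46 : ∀ X, ‖H X‖ ≤ B₀' * ‖X‖)
    {c1h ε₃ : ℝ} (hc1h : 1 ≤ c1h) (hε₃ : 0 < ε₃)
    (h18 : 18 * ((8 * (131072 * ((d : ℝ) + 1) ^ 2) * Real.exp (4 * (800 * ((d : ℝ) + 1) ^ 2 * ((d : ℝ) + 4)) * α₀)) *
      ((L : ℝ) ^ j) ^ 2) * B₀' * d * c1h * ε₃ ≤ 1) (h2 : 2 * ε₃ ≤ b / 2) (hnest : ε₄ + a ≤ ε₃)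
    {B : T → 𝔸} (hB : ‖H₀ B‖ < a ∧ ‖D2 (H₀ B)‖ < jG) (ev : X → ((S → 𝔸) →L[ℝ] E))
    {bB : BlockNorm g (T → 𝔸)} {bN : BlockNorm g (S → 𝔸)} {b3 : BlockNorm g 𝒵}
    (hev : ∀ (y : g.Site) (v : S → 𝔸), ∀ x ∈ box y, ‖ev x v‖ ≤ bN.loc y v)
    (hN : ∀ (y : g.Site) (v : S → 𝔸), bN.loc y v ≤ ‖v‖)
    (hBloc : ∀ (y' : g.Site) (μ : T → 𝔸), bB.IsLoc y' μ → ‖μ‖ ≤ bB.loc y' μ)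
    {δ₀ BG θW cΔ A₀ AH θD c : ℝ}
    (htri : Triangle254 g) (hd : ∀ a b : g.Site, 0 ≤ g.dist a b) (hδ₀ : 0 ≤ δ₀) (hrow : RowSum g (δ₀ / 8) c)
    (hc : 0 ≤ c) (hBG : 0 ≤ BG) (hθW : 0 ≤ θW) (hcΔ : 0 ≤ cΔ) (hA₀ : 0 ≤ A₀) (hAH : 0 ≤ AH) (hθD : 0 ≤ θD)
    (hG190 : HasMaj b3 bN (𝒢.restrictScalars ℝ : 𝒵 →ₗ[ℝ] (S → 𝔸)) (fun y y' => BG * Real.exp (-(δ₀ * g.dist y y'))))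
    (hD2H0 : HasMaj bB b3 ((D2 ∘L H₀).restrictScalars ℝ : (T → 𝔸) →ₗ[ℝ] 𝒵) (fun y y' => cΔ * Real.exp (-(δ₀ * g.dist y y'))))
    (hH0 : HasMaj bB bN (H₀.restrictScalars ℝ : (T → 𝔸) →ₗ[ℝ] (S → 𝔸)) (fun y y' => A₀ * Real.exp (-(δ₀ * g.dist y y'))))
    (hH : HasMaj bB bN (H.restrictScalars ℝ : (T → 𝔸) →ₗ[ℝ] (S → 𝔸)) (fun y y' => AH * Real.exp (-(δ₀ / 2 * g.dist y y'))))
    (h189 : ∀ B' : T → 𝔸, ‖H₀ B'‖ < a → ‖D2 (H₀ B')‖ < jG →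
      Ineq189 bN b3 ((fderiv ℂ W (solA180 𝒢 W D2 H₀ ε₄ B' + H₀ B')).restrictScalars ℝ : (S → 𝔸) →ₗ[ℝ] 𝒵) θW δ₀)
    (h73 : ∀ B' : T → 𝔸, ‖H₀ B'‖ < a → ‖D2 (H₀ B')‖ < jG →
      HasMaj bN bB
        ((fderiv ℂ (Dfix (B11Eq44Concrete.Cmap L U₀ S T j) (H : (T → 𝔸) →ₗ[ℂ] (S → 𝔸))
          ((8 * (131072 * ((d : ℝ) + 1) ^ 2) * Real.exp (4 * (800 * ((d : ℝ) + 1) ^ 2 * ((d : ℝ) + 4)) * α₀)) * ((L : ℝ) ^ j) ^ 2))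
          (solA180 𝒢 W D2 H₀ ε₄ B' + H₀ B')).restrictScalars ℝ : (S → 𝔸) →ₗ[ℝ] (T → 𝔸))
        (fun y y' => θD * Real.exp (-(δ₀ / 2 * g.dist y y'))))
    (hq : qG b3.κ bN.κ BG θW c < 1)
    (Hl : (T → 𝔸) → X → E) (dH : Icc (0:ℝ) 1 → (T → 𝔸) →ₗ[ℝ] (X → E))
    (hHl : ∀ B' : T → 𝔸, Hl B' = fun x => ev x (chartH179 𝒢 W D2 H₀
      (fun Y : S → 𝔸 => Y - H (Dfix (B11Eq44Concrete.Cmap L U₀ S T j) (H : (T → 𝔸) →ₗ[ℂ] (S → 𝔸))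
        ((8 * (131072 * ((d : ℝ) + 1) ^ 2) * Real.exp (4 * (800 * ((d : ℝ) + 1) ^ 2 * ((d : ℝ) + 4)) * α₀)) * ((L : ℝ) ^ j) ^ 2) Y))
      ε₄ B'))
    (hdH : ∀ t : Icc (0:ℝ) 1, dH t = (LinearMap.pi fun x => ((ev x : (S → 𝔸) →L[ℝ] E) : (S → 𝔸) →ₗ[ℝ] E)) ∘ₗ
      ((fderiv ℂ (chartH179 𝒢 W D2 H₀
        (fun Y : S → 𝔸 => Y - H (Dfix (B11Eq44Concrete.Cmap L U₀ S T j) (H : (T → 𝔸) →ₗ[ℂ] (S → 𝔸))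
          ((8 * (131072 * ((d : ℝ) + 1) ^ 2) * Real.exp (4 * (800 * ((d : ℝ) + 1) ^ 2 * ((d : ℝ) + 4)) * α₀)) * ((L : ℝ) ^ j) ^ 2) Y))
        ε₄) ((t : ℝ) • B)).restrictScalars ℝ : (T → 𝔸) →ₗ[ℝ] (S → 𝔸)))
    (y : g.Site) :
    (∀ t : Icc (0:ℝ) 1, Ineq190 bB (supSize g box blk : BlockNorm g (X → E)) (dH t)
        (const190 bB.κ bN.κ b3.κ BG θW cΔ A₀ AH θD c) δ₀) ∧
      ∀ s : ℝ, (∀ t, (supSize g box blk : BlockNorm g (X → E)).loc y (dH t B) ≤ s) →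
        (supSize g box blk : BlockNorm g (X → E)).loc y (Hl B) ≤ s := by
  have hin := B11Prop3Concrete.inputs_concrete L hL hG k U₀ hU₀ hα hα3 hα4 h52 hb hsmall hc₃ h145 h155 S T
    (H : (T → 𝔸) →ₗ[ℂ] (S → 𝔸)) hj hH46
  have hCa : AnalyticOnNhd ℂ (B11Eq44Concrete.Cmap L U₀ S T j) {Y : S → 𝔸 | ‖Y‖ < 2 * (b / 2)} := by
    have h2b : {Y : S → 𝔸 | ‖Y‖ < 2 * (b / 2)} = {Y : S → 𝔸 | ‖Y‖ < b} := by
      ext Y; simp only [Set.mem_setOf_eq]; constructor <;> intro h <;> linarith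
    rw [h2b]
    exact B12SecondOrder267Concrete.analyticOnNhd_Cmap L hL hG k U₀ hU₀ hα hα3 hα4 h52 hb hsmall hc₃ S T hj
  have hdR : (1 : ℝ) ≤ (d : ℝ) := by exact_mod_cast hd1
  have hK : (0 : ℝ) ≤ (8 * (131072 * ((d : ℝ) + 1) ^ 2) * Real.exp (4 * (800 * ((d : ℝ) + 1) ^ 2 * ((d : ℝ) + 4)) * α₀)) *
      ((L : ℝ) ^ j) ^ 2 := by positivity
  have hC3 : (0 : ℝ) ≤ 2 * (d : ℝ) * (C3Gen d L * ((L : ℝ) ^ j) ^ 2) :=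
    mul_nonneg (by positivity) (mul_nonneg (by unfold C3Gen C1ppGen; positivity) (by positivity))
  obtain ⟨-, -, h18', -, -, -⟩ := B11Prop3Concrete.smallness_concrete hK hB₀' hε₃.le hdR hc1h hb h18 h2
  exact ineq190_and_hmv_supSize_of_inputs R hWa hin hCa hK hC3 hB₀' hε₃ h18' h2 hnest hB ev hev hN hBloc htri hd hδ₀ hrow hc
    hBG hθW hcΔ hA₀ hAH hθD hG190 hD2H0 hH0 hH h189 h73 hq Hl dH hHl hdH y

end Literature.MathematicalPhysics.QuantumFieldTheory.Balaban1983to89.B11Ineq190ConcreteC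

end
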